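import Summits.QuantumAdvantage.QuantumAdvantage.Theorems.WalkThreeStepProfile
import Summits.QuantumAdvantage.QuantumAdvantage.Theorems.WalkPrefixResidueCylinders

/-!
# Rung (G♯₂) `ThreeStepFreeRungFive` (item stmt-QuantumAdvantage-23286), architecture (U), 3/3: the USABLE BOUND and the HUB COUNT

Cell qa-qnc0, route OddPrimeWalk, support item stmt-QuantumAdvantage-23286 (planner qa-qnc0-p2 g27, ROUND-27 §3.3/§4, sketch
`HOME/qa-qnc0-p2/line27/RungUSketch.lean`, modules `UsableBound` (U-a) and `HubCount` (U-b)); prover qn-prover-3 g16.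

§3 **Module U-a**: one non-degenerate position forces a constant fraction of losing inputs.  On the residue-profile cylinder of a
discordant input `u₀` (1/3, `discBit3_congr`) every input is discordant; the cylinder is a residue cylinder at `≤ 3·coSplit + 7`
positions, hence of size `≥ 2ⁿ·2^{−(3p−1)(3·coSplit+7)}` (2/3, `card_profile_ge`); and `u ↦ (the loser of {u, ψ_τ u})` injects it
into the losing inputs (`winCount_add_card_cyl_le`).  Hence `winCount_le_of_discordant` (every `p ≥ 1`, explicit constant) and, for
`p = 5`, **`usableBound : UsableBound`** with `η(M) = 2^{−14·(3M+7)}`, `m₀ = 0` — no criterion, no peeling, no classes.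
§4 **Module U-b**: `Σ_τ coSplit S τ ≤ 2(n+1)` (every cut has two splits), so **`hubCount : HubCount`**.
WHAT THIS IS NOT: not the item (modules U-c/U-d/U-e and the assembly remain); separation NOT moved.
-/

namespace Summit.QuantumAdvantage.AdviceFreeQNC0.LocalEngine

open Finset Classical

namespace RungU

variable {p n : ℕ}

/-! ### §3 The usable bound (PROVED) -/

/-- the cylinder is a residue cylinder at `≤ 3·coSplit + 7` positions, hence large. -/
theorem card_cyl_ge (hp : 1 ≤ p) (S : ThreeStep p n) {τ : ℕ} (h2 : τ < n) (u₀ : Fin n → Bool) :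
    (2 : ℝ) ^ n * ((1 / 2 : ℝ) ^ (3 * p - 1)) ^ (3 * coSplit S τ + 7) ≤ ((cyl S τ u₀).card : ℝ) := by
  have hQ : ∀ q ∈ prof S τ, q ≤ n := by
    intro q hq
    unfold prof at hq
    rw [Finset.mem_union] at hq
    rcases hq with hq | hq
    · simp only [Finset.mem_insert, Finset.mem_singleton] at hq; omega
    · rw [Finset.mem_biUnion] at hq
      obtain ⟨h, _, hx⟩ := hq
      unfold reads at hx
      simp only [Finset.mem_insert, Finset.mem_singleton] at hx; omega
  have h := card_profile_ge (3 * p) (by omega) u₀ (prof S τ) hQ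
  have hhalf : (0 : ℝ) ≤ (1 / 2 : ℝ) ^ (3 * p - 1) := pow_nonneg (by norm_num) _
  have hpow : ((1 / 2 : ℝ) ^ (3 * p - 1)) ^ (3 * coSplit S τ + 7) ≤ ((1 / 2 : ℝ) ^ (3 * p - 1)) ^ (prof S τ).card :=
    pow_le_pow_of_le_one hhalf (pow_le_one₀ (by norm_num) (by norm_num)) (card_prof_le S τ)
  have e : (cyl S τ u₀).card
      = (univ.filter fun u : Fin n → Bool => ∀ q ∈ prof S τ, wtPrefix u q % (3 * p) = wtPrefix u₀ q % (3 * p)).card := by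
    unfold cyl res
    congr 1
  rw [e]
  calc (2 : ℝ) ^ n * ((1 / 2 : ℝ) ^ (3 * p - 1)) ^ (3 * coSplit S τ + 7)
      ≤ (2 : ℝ) ^ n * ((1 / 2 : ℝ) ^ (3 * p - 1)) ^ (prof S τ).card := mul_le_mul_of_nonneg_left hpow (by positivity)
    _ ≤ _ := h

/-- **Losers from one discordant input**: the whole profile cylinder of a discordant input is discordant, and choosing the loser of
each pair `{u, ψ_τ u}` injects the cylinder into the losing inputs. -/
theorem winCount_add_card_cyl_le (hp : 1 ≤ p) (c : ℕ) (S : ThreeStep p n) (τ : ℕ) (u₀ : Fin n → Bool)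
    (h0 : discBit3 c S τ u₀ = true) : winCount c S + (cyl S τ u₀).card ≤ 2 ^ n := by
  obtain ⟨h1, h2⟩ := pos_of_discBit3 c S τ u₀ h0
  have hne : u₀ ⟨τ - 1, by omega⟩ ≠ u₀ ⟨τ, h2⟩ := by
    intro he
    have e := cornerFlip_eq_self τ u₀ h1 h2 he
    unfold discBit3 at h0
    rw [e, Bool.xor_self] at h0
    exact Bool.false_ne_true h0
  have hdisc : ∀ u ∈ cyl S τ u₀, ringWinU c S.y u ≠ ringWinU c S.y (cornerFlip n τ u) := fun u hu =>
    (discBit3_eq_true_iff c S τ u).mp ((discBit3_congr hp c S h1 h2 hu).trans h0)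
  have hnot : ∀ u ∈ cyl S τ u₀, cornerFlip n τ u ∉ cyl S τ u₀ := by
    intro u hu hψ
    have a := (bits_eq_of_mem_cyl hp S h1 h2 hu).1
    have b := (bits_eq_of_mem_cyl hp S h1 h2 hψ).1
    rw [cornerFlip_apply_left τ u h1 h2, (bits_eq_of_mem_cyl hp S h1 h2 hu).2] at b
    exact hne b.symm
  set f : (Fin n → Bool) → (Fin n → Bool) := fun u => if ringWinU c S.y u = true then cornerFlip n τ u else u with hf
  have hmaps : ∀ u ∈ cyl S τ u₀, f u ∈ (univ : Finset (Fin n → Bool)).filter fun v => ¬ ringWinU c S.y v = true := by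
    intro u hu
    rw [Finset.mem_filter]
    refine ⟨Finset.mem_univ _, ?_⟩
    by_cases hw : ringWinU c S.y u = true
    · simp only [hf, hw, if_true]
      intro h'
      exact hdisc u hu (hw.trans h'.symm)
    · simp only [hf, hw]
      exact hw
  have hinj : Set.InjOn f (cyl S τ u₀ : Set (Fin n → Bool)) := by
    intro u hu u' hu' he
    simp only [Finset.mem_coe] at hu hu'
    by_cases hw : ringWinU c S.y u = true <;> by_cases hw' : ringWinU c S.y u' = true
    · simp only [hf, hw, hw', if_true] at he
      have := congrArg (cornerFlip n τ) he
      rwa [cornerFlip_cornerFlip, cornerFlip_cornerFlip] at this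
    · simp only [hf, hw, hw', if_true] at he
      exact absurd (he ▸ hu') (hnot u hu)
    · simp only [hf, hw, hw', if_true] at he
      exact absurd (he.symm ▸ hu) (hnot u' hu')
    · simp only [hf, hw, hw'] at he
      exact he
  have hle := Finset.card_le_card_of_injOn f hmaps hinj
  have htot := Finset.card_filter_add_card_filter_not (s := (univ : Finset (Fin n → Bool)))
    (fun u => ringWinU c S.y u = true)
  rw [Finset.card_univ, Fintype.card_fun, Fintype.card_bool, Fintype.card_fin] at htot
  unfold winCount
  omega

/-- **The usable bound with explicit constant**: a discordant input at `τ` forces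
`winCount ≤ (1 − 2^{−(3p−1)(3·coSplit+7)})·2ⁿ`. -/
theorem winCount_le_of_discordant (hp : 1 ≤ p) (c : ℕ) (S : ThreeStep p n) (τ : ℕ) (u₀ : Fin n → Bool)
    (h0 : discBit3 c S τ u₀ = true) :
    (winCount c S : ℝ) ≤ (1 - ((1 / 2 : ℝ) ^ (3 * p - 1)) ^ (3 * coSplit S τ + 7)) * 2 ^ n := by
  obtain ⟨_, h2⟩ := pos_of_discBit3 c S τ u₀ h0
  have h := winCount_add_card_cyl_le hp c S τ u₀ h0
  have hr : (winCount c S : ℝ) + ((cyl S τ u₀).card : ℝ) ≤ (2 : ℝ) ^ n := by exact_mod_cast h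
  have hc := card_cyl_ge hp S h2 u₀
  nlinarith [hr, hc]

/-- **Module U-a of architecture (U)**: `UsableBound` holds, with `η(M) = 2^{−14(3M+7)}` and `m₀ = 0`. -/
theorem usableBound : UsableBound := by
  intro M
  refine ⟨((1 / 2 : ℝ) ^ 14) ^ (3 * M + 7), by positivity, 0, ?_⟩
  intro n c S τ _ _ hco hdeg
  unfold Degenerate at hdeg
  push Not at hdeg
  obtain ⟨u₀, hu₀⟩ := hdeg
  have h0 : discBit3 c S τ u₀ = true := by
    cases h : discBit3 c S τ u₀
    · exact absurd h hu₀
    · rfl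
  have h := winCount_le_of_discordant (p := 5) (by norm_num) c S τ u₀ h0
  have hhalf : (0 : ℝ) ≤ (1 / 2 : ℝ) ^ 14 := pow_nonneg (by norm_num) _
  have hpow : ((1 / 2 : ℝ) ^ 14) ^ (3 * coSplit S τ + 7) ≥ ((1 / 2 : ℝ) ^ 14) ^ (3 * M + 7) :=
    pow_le_pow_of_le_one hhalf (pow_le_one₀ (by norm_num) (by norm_num)) (by omega)
  have e : (3 * 5 - 1 : ℕ) = 14 := by norm_num
  rw [e] at h
  calc (winCount c S : ℝ) ≤ (1 - ((1 / 2 : ℝ) ^ 14) ^ (3 * coSplit S τ + 7)) * 2 ^ n := h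
    _ ≤ (1 - ((1 / 2 : ℝ) ^ 14) ^ (3 * M + 7)) * 2 ^ n := by
        apply mul_le_mul_of_nonneg_right _ (by positivity)
        linarith

/-! ### §4 The hub count (module U-b, PROVED) -/

/-- `Σ_τ coSplit S τ ≤ 2(n+1)`: every cut has at most two splits. -/
theorem sum_coSplit_le (S : ThreeStep p n) : ∑ τ ∈ range (n + 1), coSplit S τ ≤ 2 * (n + 1) := by
  have hle : ∀ τ ∈ range (n + 1), coSplit S τ ≤
      (univ.filter fun h : Fin (n + 1) => S.s h = τ).card + (univ.filter fun h : Fin (n + 1) => S.t h = τ).card := by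
    intro τ _
    unfold coSplit
    calc (univ.filter fun h : Fin (n + 1) => h.val ≠ τ ∧ Observes S h τ).card
        ≤ ((univ.filter fun h : Fin (n + 1) => S.s h = τ) ∪ (univ.filter fun h : Fin (n + 1) => S.t h = τ)).card := by
          apply Finset.card_le_card
          intro h hh
          rw [Finset.mem_filter] at hh
          rw [Finset.mem_union, Finset.mem_filter, Finset.mem_filter]
          unfold Observes at hh
          rcases hh.2.2 with h1 | h1 | h1
          · exact absurd h1 hh.2.1
          · exact Or.inl ⟨Finset.mem_univ _, h1⟩
          · exact Or.inr ⟨Finset.mem_univ _, h1⟩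
      _ ≤ _ := Finset.card_union_le _ _
  have hfib : ∀ f : Fin (n + 1) → ℕ, ∑ τ ∈ range (n + 1), (univ.filter fun h : Fin (n + 1) => f h = τ).card ≤ n + 1 := by
    intro f
    have h := Finset.card_eq_sum_card_fiberwise (s := univ.filter fun h : Fin (n + 1) => f h < n + 1) (t := range (n + 1))
      (f := f) (fun h hh => Finset.mem_range.mpr (Finset.mem_filter.mp hh).2)
    have e : ∀ τ ∈ range (n + 1), (((univ.filter fun h : Fin (n + 1) => f h < n + 1).filter fun h => f h = τ)).card
        = (univ.filter fun h : Fin (n + 1) => f h = τ).card := by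
      intro τ hτ
      congr 1
      rw [Finset.filter_filter]
      apply Finset.filter_congr
      intro h _
      rw [Finset.mem_range] at hτ
      constructor
      · exact fun hh => hh.2
      · intro hh; exact ⟨hh ▸ hτ, hh⟩
    rw [Finset.sum_congr rfl e] at h
    rw [← h]
    have := Finset.card_filter_le (univ : Finset (Fin (n + 1))) (fun h : Fin (n + 1) => f h < n + 1)
    rw [Finset.card_univ, Fintype.card_fin] at this
    exact this
  calc ∑ τ ∈ range (n + 1), coSplit S τ
      ≤ ∑ τ ∈ range (n + 1), ((univ.filter fun h : Fin (n + 1) => S.s h = τ).card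
          + (univ.filter fun h : Fin (n + 1) => S.t h = τ).card) := Finset.sum_le_sum hle
    _ = _ := Finset.sum_add_distrib
    _ ≤ (n + 1) + (n + 1) := Nat.add_le_add (hfib S.s) (hfib S.t)
    _ = 2 * (n + 1) := by ring

/-- **Module U-b of architecture (U)**: `HubCount` holds. -/
theorem hubCount : HubCount := by
  intro n M S _
  have h1 : M * ((range (n + 1)).filter fun τ => M < coSplit S τ).card
      ≤ ∑ τ ∈ (range (n + 1)).filter fun τ => M < coSplit S τ, coSplit S τ := by
    have h := Finset.card_nsmul_le_sum ((range (n + 1)).filter fun τ => M < coSplit S τ) (fun τ => coSplit S τ) M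
      (fun τ hτ => ((Finset.mem_filter.mp hτ).2).le)
    rw [smul_eq_mul] at h
    rw [mul_comm]
    exact h
  have h2 : ∑ τ ∈ (range (n + 1)).filter (fun τ => M < coSplit S τ), coSplit S τ ≤ ∑ τ ∈ range (n + 1), coSplit S τ :=
    Finset.sum_le_sum_of_subset (Finset.filter_subset _ _)
  have h3 := sum_coSplit_le S
  omega


end RungU

end Summit.QuantumAdvantage.AdviceFreeQNC0.LocalEngine
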